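import Summits.QuantumFields.YangMills.Theorems.LuscherReductionTwistedTraceScalingBTFarPairs
import HarnessLib

/-!
# (L1) TAILS: the three defect lower bounds (rough edge / mid edge with pinned amplitude / far pair) as `kinDefect ≥ m`, and the two integration lemmas
# `fpBOKernel(W)(u,u') ≤ K_max·(∫Ω dπ)²` and `fpBOKernel(W)(u,u') ≥ K_min·Haar(G_c)·(∫Ω dπ)²`
# (lane A of S-BASE, crux `TwistedTraceScaling` stmt-QuantumFields-20203, C4-CORE, the (B-T) pen; design note `pub/ym-fleet/ym-luscher-20007-p1/COARSE-DESIGN.md` §25.9)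

* `norm_su2Quat_orthoTube_sub_one_le`, `norm_su2Quat_orthoTube_sub_orthoTube_le` — tube links are within `√2‖v̂‖ + ‖q(u_k) − 1‖` of `1` and within `√2‖v̂‖ + √2‖v̂'‖ + ‖q(u_k) − q(u'_k)‖`
  of each other;
* ★ `kinDefect_ge_of_jump` — ONE edge with gauge jump `≥ P` at a site of amplitude `≤ A` gives `kinDefect ≥ (P − 2aA − b)²` ((T-rough): `A = 2`; (T-mid): `A = 9LP₀ + ε` by pinning);
* ★ `sq_le_card_mul_kinDefect_of_far` — a FAR pair (`‖q(u_k) − q(u'_k)‖ ≥ α`) with all jumps `≤ R` gives `(N(1−3LR)α − J)² ≤ |E|·kinDefect` (`…BTFarPairs.far_pair_defect_bound`);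
* ★★ `fpBOKernel_le_of_kernel_le` — if `K_β(oT u v, g·oT u' v') ≤ M` wherever `Ω(v̂)Ω(v̂')W(g) ≠ 0` (balanced capped fibres), then `fpBOKernel β Ω W u u' ≤ M·(∫W dg)·(∫Ω dπ)²`;
* ★★ `fpBOKernel_ge_of_kernel_ge` — if `K ≥ m` on `supp Ω × supp Ω × G_c` and `W ≥ 𝟙_{G_c}`, then `fpBOKernel β Ω W u u' ≥ m·Haar(G_c)·(∫Ω dπ)²`.
These turn the pointwise regime bounds into the RELATIVE tail budget of §25.9 (tail/core ≤ K_tail,max/(K_min·Haar(G_c))) with no lower bound on the fibre law needed.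
HONEST FRAMING: bookkeeping for a stub of a child of the CONDITIONAL reduction route R2b1; floor constants and the assembly are OPEN; C4-CORE OPEN; not infinite volume, not a gap, not Clay.
-/

set_option autoImplicit false

noncomputable section

open MeasureTheory Filter Topology Real
open scoped BigOperators Matrix Quaternion
open Literature.MathematicalPhysics.QuantumFieldTheory
open Literature.MathematicalPhysics.QuantumLattice

namespace Summit.QuantumFields.YangMills.Theorems.FemtoTransferGap.TwoLattice.ConstTube

open Summit.QuantumFields.YangMills.Theorems.FemtoTransferGap
open Summit.QuantumFields.YangMills.Theorems.FemtoTransferGap.TwoLattice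
open Summit.QuantumFields.YangMills.Theorems.FemtoTransferGap.TwoLattice.Avg
open Summit.QuantumFields.YangMills.Theorems.FemtoTransferGap.TwoLattice.Stiff (LinkSpace)

variable {L : ℕ} [NeZero L]

/-! ## §1 Tube links are near their slow parts -/

/-- `‖q(orthoTube u v e) − 1‖ ≤ √2‖v̂‖ + ‖q(u_k) − 1‖`. [folklore] -/
theorem norm_su2Quat_orthoTube_sub_one_le (u : GaugeConfig 3 1 SU2) {v : Edge 3 L → Fin 3 → ℝ} (hv1 : ∀ e, ∑ a, v e a ^ 2 ≤ 1) (e : Edge 3 L) :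
    ‖su2Quat (orthoTube L u v e) - 1‖ ≤ Real.sqrt 2 * ‖linkEmbed L v‖ + ‖su2Quat (u (0, e.2)) - 1‖ :=
  (norm_sub_le_norm_sub_add_norm_sub _ (su2Quat (u (0, e.2))) _).trans (add_le_add (norm_su2Quat_orthoTube_sub_le u hv1 e) le_rfl)

/-- `‖q(orthoTube u v e) − q(orthoTube u' v' e)‖ ≤ √2‖v̂‖ + √2‖v̂'‖ + ‖q(u_k) − q(u'_k)‖`. [folklore] -/
theorem norm_su2Quat_orthoTube_sub_orthoTube_le (u u' : GaugeConfig 3 1 SU2) {v v' : Edge 3 L → Fin 3 → ℝ} (hv1 : ∀ e, ∑ a, v e a ^ 2 ≤ 1)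
    (hv'1 : ∀ e, ∑ a, v' e a ^ 2 ≤ 1) (e : Edge 3 L) :
    ‖su2Quat (orthoTube L u v e) - su2Quat (orthoTube L u' v' e)‖ ≤
      Real.sqrt 2 * ‖linkEmbed L v‖ + Real.sqrt 2 * ‖linkEmbed L v'‖ + ‖su2Quat (u (0, e.2)) - su2Quat (u' (0, e.2))‖ := by
  have h1 := norm_su2Quat_orthoTube_sub_le u hv1 e
  have h2 := norm_su2Quat_orthoTube_sub_le u' hv'1 e
  have t1 := norm_sub_le_norm_sub_add_norm_sub (su2Quat (orthoTube L u v e)) (su2Quat (u (0, e.2))) (su2Quat (orthoTube L u' v' e))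
  have t2 := norm_sub_le_norm_sub_add_norm_sub (su2Quat (u (0, e.2))) (su2Quat (u' (0, e.2))) (su2Quat (orthoTube L u' v' e))
  rw [norm_sub_rev (su2Quat (u' (0, e.2))) (su2Quat (orthoTube L u' v' e))] at t2
  linarith

/-! ## §2 The regime bounds as `kinDefect ≥ m` -/

/-- ★ **One rough edge**: a gauge jump `≥ P` across an edge whose base site has amplitude `≤ A`, with `‖q(U_e) − 1‖ ≤ a`, `‖q(U_e) − q(V_e)‖ ≤ b`, gives
`kinDefect ≥ (P − 2aA − b)²`. [folklore] -/
theorem kinDefect_ge_of_jump (U V : GaugeConfig 3 L SU2) (g : Site 3 L → SU2) (e : Edge 3 L) {P a b A : ℝ}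
    (hP : P ≤ ‖su2Quat (g (e.1.shift e.2)) - su2Quat (g e.1)‖) (ha : ‖su2Quat (U e) - 1‖ ≤ a) (hb : ‖su2Quat (U e) - su2Quat (V e)‖ ≤ b)
    (hA : ‖su2Quat (g e.1) - 1‖ ≤ A) (hpos : 0 ≤ P - 2 * a * A - b) : (P - 2 * a * A - b) ^ 2 ≤ kinDefect L U V g := by
  have ha0 : 0 ≤ a := (norm_nonneg _).trans ha
  have h1 := norm_edgeDefect_ge (U e) (V e) (g e.1) (g (e.1.shift e.2))
  have h2 : ‖su2Quat (U e) - 1‖ * ‖su2Quat (g e.1) - 1‖ ≤ a * A := mul_le_mul ha hA (norm_nonneg _) ha0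
  have h3 : P - 2 * a * A - b ≤ ‖su2Quat (U e) * su2Quat (g (e.1.shift e.2)) - su2Quat (g e.1) * su2Quat (V e)‖ := by linarith
  exact (pow_le_pow_left₀ hpos h3 2).trans (sq_edgeDefect_le_kinDefect U V g e)

/-- ★ **Far pair**: on the tube, all jumps `≤ R` (`3LR < 1`), `colourMean g ∈ fpBall ε`, and `‖q(u_k) − q(u'_k)‖ ≥ α` give `(N(1−3LR)α − J)² ≤ |E|·kinDefect` once
`J ≤ N(1−3LR)α`, where `J = 2εN‖q(u_k) − 1‖ + ‖v̂‖² + ‖v̂'‖² + √2N(9LR + ε)(‖v̂‖ + ‖v̂'‖)`. [cite: Luscher1983, §3] -/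
theorem sq_le_card_mul_kinDefect_of_far (u u' : GaugeConfig 3 1 SU2) {v v' : Edge 3 L → Fin 3 → ℝ} (hv : v ∈ capBalancedSet L) (hv' : v' ∈ capBalancedSet L)
    {g : Site 3 L → SU2} {R ε α : ℝ} (hR : ∀ e : Edge 3 L, ‖su2Quat (g (e.1.shift e.2)) - su2Quat (g e.1)‖ ≤ R) (hR1 : 3 * L * R < 1) (hε : 0 ≤ ε)
    (hW : colourMean L g ∈ fpBall ε) (k : Fin 3) (hα : α ≤ ‖su2Quat (u (0, k)) - su2Quat (u' (0, k))‖)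
    (hJ : 2 * ε * Fintype.card (Site 3 L) * ‖su2Quat (u (0, k)) - 1‖ + ‖linkEmbed L v‖ ^ 2 + ‖linkEmbed L v'‖ ^ 2 +
        Real.sqrt 2 * Fintype.card (Site 3 L) * (9 * L * R + ε) * (‖linkEmbed L v‖ + ‖linkEmbed L v'‖) ≤ Fintype.card (Site 3 L) * (1 - 3 * L * R) * α) :
    (Fintype.card (Site 3 L) * (1 - 3 * L * R) * α - (2 * ε * Fintype.card (Site 3 L) * ‖su2Quat (u (0, k)) - 1‖ + ‖linkEmbed L v‖ ^ 2 + ‖linkEmbed L v'‖ ^ 2 +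
        Real.sqrt 2 * Fintype.card (Site 3 L) * (9 * L * R + ε) * (‖linkEmbed L v‖ + ‖linkEmbed L v'‖))) ^ 2 ≤
      (Fintype.card (Edge 3 L) : ℝ) * kinDefect L (orthoTube L u v) (orthoTube L u' v') g := by
  have hfar := far_pair_defect_bound u u' hv hv' hR hR1 hε hW k
  have hN : (0 : ℝ) ≤ Fintype.card (Site 3 L) * (1 - 3 * L * R) := mul_nonneg (Nat.cast_nonneg _) (by linarith)
  have hmono : (Fintype.card (Site 3 L) : ℝ) * (1 - 3 * L * R) * α ≤ Fintype.card (Site 3 L) * (1 - 3 * L * R) * ‖su2Quat (u (0, k)) - su2Quat (u' (0, k))‖ :=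
    mul_le_mul_of_nonneg_left hα hN
  refine le_trans (pow_le_pow_left₀ (by linarith) (show _ ≤ ∑ e : Edge 3 L, ‖su2Quat (orthoTube L u v e) * su2Quat (g (e.1.shift e.2)) - su2Quat (g e.1) * su2Quat (orthoTube L u' v' e)‖
    by linarith) 2) (sq_sum_norm_edgeDefect_le _ _ _)

/-! ## §3 The two integration lemmas -/

/-- The balanced caps hold almost everywhere on the product space. [folklore] -/
theorem ae_prod_mem_capBalancedSet :
    ∀ᵐ p ∂((orthoTransverse L).prod ((orthoTransverse L).prod (gaugeMeasure L))),
      (p : (Edge 3 L → Fin 3 → ℝ) × ((Edge 3 L → Fin 3 → ℝ) × (Site 3 L → SU2))).1 ∈ capBalancedSet L ∧ p.2.1 ∈ capBalancedSet L := by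
  have hcapπ : ∀ᵐ v ∂orthoTransverse L, v ∈ capBalancedSet L := by
    rw [ae_iff]; have h0 := orthoTransverse_compl_capBalancedSet L; simpa only [Set.compl_def] using h0
  have hcap1 : ∀ᵐ p ∂((orthoTransverse L).prod ((orthoTransverse L).prod (gaugeMeasure L))),
      (p : (Edge 3 L → Fin 3 → ℝ) × ((Edge 3 L → Fin 3 → ℝ) × (Site 3 L → SU2))).1 ∈ capBalancedSet L :=
    (Measure.quasiMeasurePreserving_fst (μ := orthoTransverse L) (ν := (orthoTransverse L).prod (gaugeMeasure L))).ae hcapπ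
  have h2 : ∀ᵐ q ∂((orthoTransverse L).prod (gaugeMeasure L)), (q : (Edge 3 L → Fin 3 → ℝ) × (Site 3 L → SU2)).1 ∈ capBalancedSet L :=
    (Measure.quasiMeasurePreserving_fst (μ := orthoTransverse L) (ν := gaugeMeasure L)).ae hcapπ
  have hcap2 : ∀ᵐ p ∂((orthoTransverse L).prod ((orthoTransverse L).prod (gaugeMeasure L))),
      (p : (Edge 3 L → Fin 3 → ℝ) × ((Edge 3 L → Fin 3 → ℝ) × (Site 3 L → SU2))).2.1 ∈ capBalancedSet L :=
    (Measure.quasiMeasurePreserving_snd (μ := orthoTransverse L) (ν := (orthoTransverse L).prod (gaugeMeasure L))).ae h2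
  filter_upwards [hcap1, hcap2] with p h1 h2 using ⟨h1, h2⟩

/-- The product of the profile weights integrates to `(∫W dg)·(∫Ω dπ)²`. [folklore] -/
theorem integral_prod_profile (Ω : LinkSpace L → ℝ) (W : (Site 3 L → SU2) → ℝ) :
    ∫ p, Ω (linkEmbed L p.1) * (W p.2.2 * Ω (linkEmbed L p.2.1)) ∂((orthoTransverse L).prod ((orthoTransverse L).prod (gaugeMeasure L))) =
      (∫ g, W g ∂gaugeMeasure L) * (∫ v, Ω (linkEmbed L v) ∂orthoTransverse L) ^ 2 := by
  haveI := isFiniteMeasure_orthoTransverse L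
  have h1 := integral_prod_mul (μ := orthoTransverse L) (ν := (orthoTransverse L).prod (gaugeMeasure L)) (fun v => Ω (linkEmbed L v))
    (fun q : (Edge 3 L → Fin 3 → ℝ) × (Site 3 L → SU2) => W q.2 * Ω (linkEmbed L q.1))
  have h2 := integral_prod_mul (μ := orthoTransverse L) (ν := gaugeMeasure L) (fun v' => Ω (linkEmbed L v')) (fun g => W g)
  have e2 : (fun q : (Edge 3 L → Fin 3 → ℝ) × (Site 3 L → SU2) => W q.2 * Ω (linkEmbed L q.1)) = fun q => Ω (linkEmbed L q.1) * W q.2 := by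
    funext q; ring
  rw [h1, e2, h2]; ring

/-- ★★ **Tail integration**: a pointwise kernel bound `K ≤ M` on `supp Ω × supp Ω × supp W` (balanced capped fibres) gives `fpBOKernel ≤ M·(∫W)·(∫Ω)²`. [folklore] -/
theorem fpBOKernel_le_of_kernel_le (β : ℝ) {Ω : LinkSpace L → ℝ} (hΩm : Measurable Ω) {CΩ : ℝ} (hCΩ : ∀ x, |Ω x| ≤ CΩ) (hΩ0 : ∀ x, 0 ≤ Ω x)
    {W : (Site 3 L → SU2) → ℝ} (hW : Measurable W) {CW : ℝ} (hCW : ∀ g, |W g| ≤ CW) (hW0 : ∀ g, 0 ≤ W g) (u u' : GaugeConfig 3 1 SU2) {M : ℝ} (hM0 : 0 ≤ M)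
    (hK : ∀ (v v' : Edge 3 L → Fin 3 → ℝ) (g : Site 3 L → SU2), v ∈ capBalancedSet L → v' ∈ capBalancedSet L → Ω (linkEmbed L v) ≠ 0 → Ω (linkEmbed L v') ≠ 0 →
      W g ≠ 0 → transferKernel su2Rep β (orthoTube L u v) (gaugeTransform g (orthoTube L u' v')) ≤ M) :
    fpBOKernel L β Ω W u u' ≤ M * (∫ g, W g ∂gaugeMeasure L) * (∫ v, Ω (linkEmbed L v) ∂orthoTransverse L) ^ 2 := by
  haveI := isFiniteMeasure_orthoTransverse L
  rw [fpBOKernel_eq_integral_prod β hΩm hCΩ hW hCW, mul_assoc, ← integral_prod_profile, ← integral_const_mul]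
  obtain ⟨B, hB⟩ := abs_fpTriple_le (L := L) β hCΩ hCW u u'
  have hCΩ0 : 0 ≤ CΩ := (abs_nonneg _).trans (hCΩ 0)
  have hCW0 : 0 ≤ CW := (abs_nonneg _).trans (hCW 1)
  have hint1 : Integrable (fpTriple L β Ω W u u') ((orthoTransverse L).prod ((orthoTransverse L).prod (gaugeMeasure L))) :=
    integrable_of_measurable_abs_le _ (measurable_fpTriple β hΩm hW u u') hB
  have hmeas2 : Measurable fun p : (Edge 3 L → Fin 3 → ℝ) × ((Edge 3 L → Fin 3 → ℝ) × (Site 3 L → SU2)) => M * (Ω (linkEmbed L p.1) * (W p.2.2 * Ω (linkEmbed L p.2.1))) :=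
    measurable_const.mul ((hΩm.comp ((measurable_linkEmbed L).comp measurable_fst)).mul
      ((hW.comp (measurable_snd.comp measurable_snd)).mul (hΩm.comp ((measurable_linkEmbed L).comp (measurable_fst.comp measurable_snd)))))
  have hint2 : Integrable (fun p : (Edge 3 L → Fin 3 → ℝ) × ((Edge 3 L → Fin 3 → ℝ) × (Site 3 L → SU2)) => M * (Ω (linkEmbed L p.1) * (W p.2.2 * Ω (linkEmbed L p.2.1))))
      ((orthoTransverse L).prod ((orthoTransverse L).prod (gaugeMeasure L))) := by
    refine integrable_of_measurable_abs_le _ hmeas2 (C := M * (CΩ * (CW * CΩ))) fun p => ?_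
    rw [abs_mul, abs_of_nonneg hM0, abs_mul, abs_mul]
    exact mul_le_mul_of_nonneg_left (mul_le_mul (hCΩ _) (mul_le_mul (hCW _) (hCΩ _) (abs_nonneg _) hCW0) (mul_nonneg (abs_nonneg _) (abs_nonneg _)) hCΩ0) hM0
  refine integral_mono_ae hint1 hint2 ?_
  filter_upwards [ae_prod_mem_capBalancedSet (L := L)] with p hp
  unfold fpTriple
  by_cases hΩv : Ω (linkEmbed L p.1) = 0
  · rw [hΩv]; simp
  by_cases hΩv' : Ω (linkEmbed L p.2.1) = 0
  · rw [hΩv']; simp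
  by_cases hWg : W p.2.2 = 0
  · rw [hWg]; simp
  have hKle := hK p.1 p.2.1 p.2.2 hp.1 hp.2 hΩv hΩv' hWg
  have h1 : W p.2.2 * transferKernel su2Rep β (orthoTube L u p.1) (gaugeTransform p.2.2 (orthoTube L u' p.2.1)) * Ω (linkEmbed L p.2.1) ≤
      M * (W p.2.2 * Ω (linkEmbed L p.2.1)) := by
    have := mul_le_mul_of_nonneg_left hKle (mul_nonneg (hW0 p.2.2) (hΩ0 (linkEmbed L p.2.1)))
    nlinarith [this]
  have h2 := mul_le_mul_of_nonneg_left h1 (hΩ0 (linkEmbed L p.1))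
  nlinarith [h2]

/-- ★★ **Floor integration**: a pointwise kernel LOWER bound `K ≥ m` on `supp Ω × supp Ω × G_c` (balanced capped fibres) and `W ≥ 𝟙_{G_c}` give
`fpBOKernel ≥ m·Haar(G_c)·(∫Ω)²`. [folklore] -/
theorem fpBOKernel_ge_of_kernel_ge (β : ℝ) {Ω : LinkSpace L → ℝ} (hΩm : Measurable Ω) {CΩ : ℝ} (hCΩ : ∀ x, |Ω x| ≤ CΩ) (hΩ0 : ∀ x, 0 ≤ Ω x)
    {W : (Site 3 L → SU2) → ℝ} (hW : Measurable W) {CW : ℝ} (hCW : ∀ g, |W g| ≤ CW) (hW0 : ∀ g, 0 ≤ W g) {Gc : Set (Site 3 L → SU2)} (hGc : MeasurableSet Gc)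
    (hWG : ∀ g ∈ Gc, 1 ≤ W g) (u u' : GaugeConfig 3 1 SU2) {m : ℝ} (hm0 : 0 ≤ m)
    (hK : ∀ (v v' : Edge 3 L → Fin 3 → ℝ) (g : Site 3 L → SU2), v ∈ capBalancedSet L → v' ∈ capBalancedSet L → Ω (linkEmbed L v) ≠ 0 → Ω (linkEmbed L v') ≠ 0 →
      g ∈ Gc → m ≤ transferKernel su2Rep β (orthoTube L u v) (gaugeTransform g (orthoTube L u' v'))) :
    m * (gaugeMeasure L).real Gc * (∫ v, Ω (linkEmbed L v) ∂orthoTransverse L) ^ 2 ≤ fpBOKernel L β Ω W u u' := by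
  haveI := isFiniteMeasure_orthoTransverse L
  have hind : (gaugeMeasure L).real Gc = ∫ g, Gc.indicator (fun _ => (1 : ℝ)) g ∂gaugeMeasure L := by
    rw [integral_indicator hGc, setIntegral_const, smul_eq_mul, mul_one]
  rw [fpBOKernel_eq_integral_prod β hΩm hCΩ hW hCW, hind, mul_assoc, ← integral_prod_profile, ← integral_const_mul]
  obtain ⟨B, hB⟩ := abs_fpTriple_le (L := L) β hCΩ hCW u u'
  have hCΩ0 : 0 ≤ CΩ := (abs_nonneg _).trans (hCΩ 0)
  have hint1 : Integrable (fpTriple L β Ω W u u') ((orthoTransverse L).prod ((orthoTransverse L).prod (gaugeMeasure L))) :=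
    integrable_of_measurable_abs_le _ (measurable_fpTriple β hΩm hW u u') hB
  have hmi : Measurable (Gc.indicator fun _ : Site 3 L → SU2 => (1 : ℝ)) := measurable_const.indicator hGc
  have hmeas2 : Measurable fun p : (Edge 3 L → Fin 3 → ℝ) × ((Edge 3 L → Fin 3 → ℝ) × (Site 3 L → SU2)) =>
      m * (Ω (linkEmbed L p.1) * (Gc.indicator (fun _ => (1 : ℝ)) p.2.2 * Ω (linkEmbed L p.2.1))) :=
    measurable_const.mul ((hΩm.comp ((measurable_linkEmbed L).comp measurable_fst)).mul
      ((hmi.comp (measurable_snd.comp measurable_snd)).mul (hΩm.comp ((measurable_linkEmbed L).comp (measurable_fst.comp measurable_snd)))))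
  have hib : ∀ g, |Gc.indicator (fun _ : Site 3 L → SU2 => (1 : ℝ)) g| ≤ 1 := fun g => by
    by_cases hg : g ∈ Gc
    · rw [Set.indicator_of_mem hg, abs_one]
    · rw [Set.indicator_of_notMem hg, abs_zero]; exact zero_le_one
  have hint2 : Integrable (fun p : (Edge 3 L → Fin 3 → ℝ) × ((Edge 3 L → Fin 3 → ℝ) × (Site 3 L → SU2)) =>
      m * (Ω (linkEmbed L p.1) * (Gc.indicator (fun _ => (1 : ℝ)) p.2.2 * Ω (linkEmbed L p.2.1)))) ((orthoTransverse L).prod ((orthoTransverse L).prod (gaugeMeasure L))) := by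
    refine integrable_of_measurable_abs_le _ hmeas2 (C := m * (CΩ * (1 * CΩ))) fun p => ?_
    rw [abs_mul, abs_of_nonneg hm0, abs_mul, abs_mul]
    exact mul_le_mul_of_nonneg_left (mul_le_mul (hCΩ _) (mul_le_mul (hib _) (hCΩ _) (abs_nonneg _) zero_le_one) (mul_nonneg (abs_nonneg _) (abs_nonneg _)) hCΩ0) hm0
  refine integral_mono_ae hint2 hint1 ?_
  filter_upwards [ae_prod_mem_capBalancedSet (L := L)] with p hp
  unfold fpTriple
  by_cases hg : p.2.2 ∈ Gc
  · rw [Set.indicator_of_mem hg]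
    by_cases hΩv : Ω (linkEmbed L p.1) = 0
    · rw [hΩv]; simp
    by_cases hΩv' : Ω (linkEmbed L p.2.1) = 0
    · rw [hΩv']; simp
    have hKge := hK p.1 p.2.1 p.2.2 hp.1 hp.2 hΩv hΩv' hg
    have hW1 := hWG _ hg
    have hK0 : 0 ≤ transferKernel su2Rep β (orthoTube L u p.1) (gaugeTransform p.2.2 (orthoTube L u' p.2.1)) := (transferKernel_pos _ _ _ _).le
    have h1 : m * (1 * Ω (linkEmbed L p.2.1)) ≤ W p.2.2 * transferKernel su2Rep β (orthoTube L u p.1) (gaugeTransform p.2.2 (orthoTube L u' p.2.1)) * Ω (linkEmbed L p.2.1) := by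
      have := mul_le_mul hW1 hKge hm0 (hW0 _)
      nlinarith [this, hΩ0 (linkEmbed L p.2.1)]
    nlinarith [mul_le_mul_of_nonneg_left h1 (hΩ0 (linkEmbed L p.1))]
  · rw [Set.indicator_of_notMem hg]
    have : 0 ≤ Ω (linkEmbed L p.1) * (W p.2.2 * transferKernel su2Rep β (orthoTube L u p.1) (gaugeTransform p.2.2 (orthoTube L u' p.2.1)) * Ω (linkEmbed L p.2.1)) :=
      mul_nonneg (hΩ0 _) (mul_nonneg (mul_nonneg (hW0 _) (transferKernel_pos _ _ _ _).le) (hΩ0 _))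
    simpa using this

end Summit.QuantumFields.YangMills.Theorems.FemtoTransferGap.TwoLattice.ConstTube

end
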